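import Literature.AlgebraicGeometry.Resolution.BlowupFittingIdealFlatGeneral
import Mathlib.RingTheory.Flat.LocallyFree
import Mathlib.RingTheory.LocalProperties.FinitePresentation
import HarnessLib

/-!
# The strict transform is finite locally free: finite presentation (Raynaud–Gruson 5.4.2–5.4.3)

Topic: `Literature/AlgebraicGeometry/Resolution`. Complement to
`BlowupFittingIdealFlatGeneral.lean`: the strict transform `(R' ⊗_R B)/(c-power torsion)` is
not only flat but finitely presented — it is a finite flat `R'`-module of constant rank `r`,
hence Zariski-locally free (Stacks 00NX; Mathlib
`Module.Free.away_of_finite_of_flat_of_rankAtStalk_constant`), hence of finite presentation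
(finite presentation is Zariski-local, Mathlib `Module.FinitePresentation.of_localizationSpan`).
This is the "of finite presentation" half of the conclusion of Stacks 081R / 0811 ("the strict
transform is flat and of finite presentation", indeed finite locally free of rank `r`).

* `finitePresentation_of_finite_flat_rankAtStalk_eq` — a finite flat module of constant rank
  is finitely presented;
* `rankAtStalk_strictTransform_admissible` — the strict transform has constant rank `r`;
* `finitePresentation_strictTransform_admissible` — **the strict transform is a finitely
  presented `R'`-module.**

## References

* M. Raynaud, L. Gruson, *Critères de platitude et de projectivité*, Invent. Math. 13 (1971),
  Première partie, 5.4.2, 5.4.3. [RaynaudGruson1971]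
* The Stacks Project, Tags 0811, 081R, 00NX, 07ZD. [StacksProject]
-/

namespace Literature.AlgebraicGeometry.Resolution

universe u

open TensorProduct Literature.RingTheory.FittingIdeal

/-- **A finite flat module of constant rank is finitely presented** (it is Zariski-locally
free, Stacks 00NX, and finite presentation is Zariski-local). [cite: StacksProject, Tag 00NX] -/
theorem finitePresentation_of_finite_flat_rankAtStalk_eq {A : Type u} [CommRing A] {M : Type u}
    [AddCommGroup M] [Module A M] [Module.Finite A M] [Module.Flat A M] (r : ℕ)
    (h : ∀ p : PrimeSpectrum A, Module.rankAtStalk M p = r) : Module.FinitePresentation A M := by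
  have key : ∀ p : PrimeSpectrum A, ∃ a ∉ p.asIdeal,
      Module.Free (Localization.Away a) (LocalizedModule.Away a M) := fun p =>
    Module.Free.away_of_finite_of_flat_of_rankAtStalk_constant M p.asIdeal
      (fun m _ => by rw [h, h])
  choose a ha hfree using key
  refine Module.FinitePresentation.of_localizationSpan (Set.range a) ?_ fun g => ?_
  · by_contra hne
    obtain ⟨m, hm, hle⟩ := Ideal.exists_le_maximal _ hne
    exact ha ⟨m, hm.isPrime⟩ (hle (Ideal.subset_span ⟨⟨m, hm.isPrime⟩, rfl⟩))
  · obtain ⟨_, p, rfl⟩ := g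
    haveI := hfree p
    exact Module.finitePresentation_of_projective _ _

variable {R : Type u} [CommRing R] {B : Type u} [AddCommGroup B] [Module R B]
variable {R' : Type u} [CommRing R'] [Algebra R R']

/-- **The strict transform has constant rank `r`.** [cite: RaynaudGruson1971, Première partie 5.4.2] -/
theorem rankAtStalk_strictTransform_admissible [Module.Finite R B] {r : ℕ} {I K : Ideal R}
    (hI : Module.fittingIdeal R B r = I)
    (hK : ∀ k < r, ∃ n : ℕ, K ^ n * Module.fittingIdeal R B k = ⊥)
    {t₁ c : R'} (hdiv : t₁ ∣ c) (hIR' : I.map (algebraMap R R') = Ideal.span {t₁})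
    (hc : c ∈ nonZeroDivisors R') {m : ℕ} (hcK : c ^ m ∈ K.map (algebraMap R R'))
    (p : PrimeSpectrum R') :
    Module.rankAtStalk ((R' ⊗[R] B) ⧸ (⨆ n : ℕ, Submodule.torsionBy R' (R' ⊗[R] B) (c ^ n))) p
      = r := by
  obtain ⟨bas⟩ := nonempty_basis_localized_strictTransform_admissible hI hK hdiv hIR' hc hcK
    p.asIdeal (Localization.AtPrime p.asIdeal) (LocalizedModule.mkLinearMap p.asIdeal.primeCompl _)
  rw [Module.rankAtStalk, Module.finrank_eq_card_basis bas, Fintype.card_fin]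

/-- **The strict transform along a `U`-admissible blowing up of a Fitting ideal is a finitely
presented module** (indeed finite locally free of rank `r`): with the hypotheses of
`flat_strictTransform_admissible`, `(R' ⊗_R B)/(c-power torsion)` is finitely presented over
`R'`. [cite: RaynaudGruson1971, Première partie 5.4.2; StacksProject, Tag 0811] -/
theorem finitePresentation_strictTransform_admissible [Module.Finite R B] {r : ℕ} {I K : Ideal R}
    (hI : Module.fittingIdeal R B r = I)
    (hK : ∀ k < r, ∃ n : ℕ, K ^ n * Module.fittingIdeal R B k = ⊥)
    {t₁ c : R'} (hdiv : t₁ ∣ c) (hIR' : I.map (algebraMap R R') = Ideal.span {t₁})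
    (hc : c ∈ nonZeroDivisors R') {m : ℕ} (hcK : c ^ m ∈ K.map (algebraMap R R')) :
    Module.FinitePresentation R'
      ((R' ⊗[R] B) ⧸ (⨆ n : ℕ, Submodule.torsionBy R' (R' ⊗[R] B) (c ^ n))) := by
  haveI := flat_strictTransform_admissible hI hK hdiv hIR' hc hcK
  exact finitePresentation_of_finite_flat_rankAtStalk_eq r
    (rankAtStalk_strictTransform_admissible hI hK hdiv hIR' hc hcK)

end Literature.AlgebraicGeometry.Resolution
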